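import Summits.QuantumFields.YangMills.Theorems.LuscherReductionTwistedTraceScalingFPWeightIntegrand
import HarnessLib

/-!
# (N3) part 1 — global colour rotations act EQUIVARIANTLY on the Laplace data: `fB(Ad ξ, Ad p) = Ad·fB(ξ, p)` and `basedLin(Ad p)∘Ad = adL∘basedLin p`
# (lane A of S-BASE, crux `TwistedTraceScaling` stmt-QuantumFields-20203, C4 INNER; design note `pub/ym-fleet/ym-luscher-20007-p1/COARSE-DESIGN.md` §23.11 (N3))

The (N3) mechanism of record (§23.11): both first-order variations of `p ↦ normDet(A_p)` vanish because `normDet(A_p)` is invariant under the global colour rotations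
`p = (w, c) ↦ (Ad_g w, Ad_g c)` and an `Ad`-invariant linear functional on a sum of `ℝ³`'s is zero.  THIS FILE is the equivariance input:
* the linear actions `adSiteL g` (based gauge parameters), `adParamL g` (base points `(w, c)`; balance is preserved), `adDomL g` (the product domain), all continuous linear;
* ★ `actCfg_ad`: `actCfg(Ad ξ, Ad w, Ad c) = g · actCfg(ξ, w, c) · g⁻¹` near `0` (`chartSU2_adRot`); ★★ `basedFn_ad`: `fB(adDomL g z) = adL g (fB z)` for `‖z‖ ≤ 1/4`
  (`relLinkVec_conj`, `…RecordWeightConj`);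
* ★★ `basedLin_ad`: `basedLin (adParamL g p) (adSiteL g ξ) = adL g (basedLin p ξ)` for `p` near `0` (chain rule on the local identity; `fderiv` of both sides).
HONEST FRAMING: symmetry bookkeeping for a stub of a child of the CONDITIONAL reduction route R2b1; no spectral claim; C4 OPEN; not a gap, not Clay.
-/

set_option autoImplicit false

noncomputable section

open Filter Topology Real Metric
open scoped BigOperators Matrix
open Literature.MathematicalPhysics.QuantumFieldTheory
open Literature.MathematicalPhysics.QuantumLattice

namespace Summit.QuantumFields.YangMills.Theorems.FemtoTransferGap.TwoLattice.ConstTube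

open Summit.QuantumFields.YangMills.Theorems.FemtoTransferGap
open Summit.QuantumFields.YangMills.Theorems.FemtoTransferGap.TwoLattice.Stiff (LinkSpace)
open Literature.Algebra.EuclideanLattices (abs_apply_le_norm)

variable (L : ℕ) [NeZero L]

/-! ## §1 The linear actions of a global colour rotation -/

/-- `Ad_g` on based gauge parameters (sitewise rotation; basedness is preserved). [folklore] -/
def adSiteL (g : SU2) : basedSubmodule L →L[ℝ] basedSubmodule L :=
  LinearMap.toContinuousLinearMap
    { toFun := fun ξ => ⟨fun x => (adRot g).mulVec ((ξ : Site 3 L → Fin 3 → ℝ) x), by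
        show (adRot g).mulVec ((ξ : Site 3 L → Fin 3 → ℝ) 0) = 0
        rw [show (ξ : Site 3 L → Fin 3 → ℝ) 0 = 0 from ξ.2, Matrix.mulVec_zero]⟩
      map_add' := fun a b => by
        apply Subtype.ext; funext x
        simp only [Submodule.coe_add, Pi.add_apply, Matrix.mulVec_add]
      map_smul' := fun r a => by
        apply Subtype.ext; funext x
        simp only [Submodule.coe_smul, Pi.smul_apply, Matrix.mulVec_smul, RingHom.id_apply] }

/-- Components. [folklore] -/
@[simp] theorem adSiteL_apply (g : SU2) (ξ : basedSubmodule L) (x : Site 3 L) :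
    (adSiteL L g ξ : Site 3 L → Fin 3 → ℝ) x = (adRot g).mulVec ((ξ : Site 3 L → Fin 3 → ℝ) x) := rfl

/-- `Ad_g` on base points `(w, c)` (edgewise / per-direction rotation; balance is preserved). [folklore] -/
def adParamL (g : SU2) : (balancedSubmodule L × (Fin 3 → Fin 3 → ℝ)) →L[ℝ] (balancedSubmodule L × (Fin 3 → Fin 3 → ℝ)) :=
  LinearMap.toContinuousLinearMap
    { toFun := fun p => (⟨colourRotate L (fun _ => g) (p.1 : Edge 3 L → Fin 3 → ℝ), colourRotate_mem_balancedSet L p.1.2⟩,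
        fun k => (adRot g).mulVec (p.2 k))
      map_add' := fun a b => by
        refine Prod.ext (Subtype.ext (funext fun e => ?_)) (funext fun k => ?_)
        · simp only [Submodule.coe_add, Prod.fst_add, colourRotate, Pi.add_apply, Matrix.mulVec_add]
        · simp only [Prod.snd_add, Pi.add_apply, Matrix.mulVec_add]
      map_smul' := fun r a => by
        refine Prod.ext (Subtype.ext (funext fun e => ?_)) (funext fun k => ?_)
        · simp only [Submodule.coe_smul, Prod.smul_fst, colourRotate, Pi.smul_apply, Matrix.mulVec_smul, RingHom.id_apply]
        · simp only [Prod.smul_snd, Pi.smul_apply, Matrix.mulVec_smul, RingHom.id_apply] }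

/-- Components (stiff coordinate). [folklore] -/
@[simp] theorem adParamL_fst (g : SU2) (p : balancedSubmodule L × (Fin 3 → Fin 3 → ℝ)) (e : Edge 3 L) :
    ((adParamL L g p).1 : Edge 3 L → Fin 3 → ℝ) e = (adRot g).mulVec ((p.1 : Edge 3 L → Fin 3 → ℝ) e) := rfl

/-- Components (slow coordinate). [folklore] -/
@[simp] theorem adParamL_snd (g : SU2) (p : balancedSubmodule L × (Fin 3 → Fin 3 → ℝ)) (k : Fin 3) :
    (adParamL L g p).2 k = (adRot g).mulVec (p.2 k) := rfl

/-- `Ad_g` on the product domain. [folklore] -/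
def adDomL (g : SU2) : BasedDom L →L[ℝ] BasedDom L := (adSiteL L g).prodMap (adParamL L g)

/-- Components. [folklore] -/
@[simp] theorem adDomL_apply (g : SU2) (z : BasedDom L) : adDomL L g z = (adSiteL L g z.1, adParamL L g z.2) := rfl

/-- The action at most doubles sup norms: `‖Ad_g v‖∞ ≤ 2‖v‖∞` on every component. [folklore] -/
theorem norm_adDomL_le (g : SU2) (z : BasedDom L) : ‖adDomL L g z‖ ≤ 2 * ‖z‖ := by
  have h0 : 0 ≤ ‖z‖ := norm_nonneg z
  have h1 : ‖adSiteL L g z.1‖ ≤ 2 * ‖z‖ := by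
    rw [Submodule.coe_norm]
    refine (pi_norm_le_iff_of_nonneg (by positivity)).mpr fun x => ?_
    rw [adSiteL_apply]
    calc _ ≤ 2 * ‖(z.1 : Site 3 L → Fin 3 → ℝ) x‖ := norm_adRot_mulVec_le g _
      _ ≤ 2 * ‖z‖ := by
          have := (norm_le_pi_norm (z.1 : Site 3 L → Fin 3 → ℝ) x).trans (norm_fst_le z)
          linarith
  have h2 : ‖(adParamL L g z.2).1‖ ≤ 2 * ‖z‖ := by
    rw [Submodule.coe_norm]
    refine (pi_norm_le_iff_of_nonneg (by positivity)).mpr fun e => ?_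
    rw [adParamL_fst]
    calc _ ≤ 2 * ‖(z.2.1 : Edge 3 L → Fin 3 → ℝ) e‖ := norm_adRot_mulVec_le g _
      _ ≤ 2 * ‖z‖ := by
          have := ((norm_le_pi_norm (z.2.1 : Edge 3 L → Fin 3 → ℝ) e).trans (norm_fst_le z.2)).trans (norm_snd_le z)
          linarith
  have h3 : ‖(adParamL L g z.2).2‖ ≤ 2 * ‖z‖ := by
    refine (pi_norm_le_iff_of_nonneg (by positivity)).mpr fun k => ?_
    rw [adParamL_snd]
    calc _ ≤ 2 * ‖z.2.2 k‖ := norm_adRot_mulVec_le g _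
      _ ≤ 2 * ‖z‖ := by
          have := ((norm_le_pi_norm z.2.2 k).trans (norm_snd_le z.2)).trans (norm_snd_le z)
          linarith
  rw [adDomL_apply, Prod.norm_def, Prod.norm_def]
  exact max_le h1 (max_le h2 h3)

/-! ## §2 Equivariance of the transformed tube point and of its relative coordinate -/

/-- ★ `actCfg(Ad ξ, (Ad w, Ad c)) = g · actCfg(ξ, (w, c)) · g⁻¹` for `‖z‖ ≤ 1/2`. [folklore] -/
theorem actCfg_ad (g : SU2) (z : BasedDom L) (hz : ‖z‖ ≤ 1 / 2) :
    actCfg L (basedIncl L (adDomL L g z)) = gaugeTransform (fun _ => g) (actCfg L (basedIncl L z)) := by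
  have hsq : ∀ v : Fin 3 → ℝ, ‖v‖ ≤ 1 / 2 → ∑ a, v a ^ 2 ≤ 1 := fun v hv => by
    have h3 := sum_sq_le_three_norm_sq v; nlinarith [norm_nonneg v]
  have hξ : ∀ x, ∑ a, (z.1 : Site 3 L → Fin 3 → ℝ) x a ^ 2 ≤ 1 := fun x =>
    hsq _ ((norm_le_pi_norm _ x).trans ((norm_fst_le z).trans hz))
  have hw : ∀ e, ∑ a, (z.2.1 : Edge 3 L → Fin 3 → ℝ) e a ^ 2 ≤ 1 := fun e =>
    hsq _ ((norm_le_pi_norm _ e).trans (((norm_fst_le z.2).trans (norm_snd_le z)).trans hz))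
  have hc : ∀ k, ∑ a, z.2.2 k a ^ 2 ≤ 1 := fun k =>
    hsq _ ((norm_le_pi_norm _ k).trans (((norm_snd_le z.2).trans (norm_snd_le z)).trans hz))
  funext e
  rw [actCfg_apply, gaugeTransform_const_apply', actCfg_apply]
  simp only [basedIncl_apply, adDomL_apply, adSiteL_apply, adParamL_fst, adParamL_snd]
  rw [chartSU2_adRot g (hξ _), chartSU2_adRot g (hw _), chartSU2_adRot g (hc _), chartSU2_adRot g (hξ _)]
  group

/-- ★★ **Equivariance of `fB`**: `fB(Ad z) = adL g (fB z)` for `‖z‖ ≤ 1/2`. [folklore] -/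
theorem basedFn_ad (g : SU2) (z : BasedDom L) (hz : ‖z‖ ≤ 1 / 2) : basedFn L (adDomL L g z) = adL L g (basedFn L z) := by
  unfold basedFn
  rw [actCfg_ad L g z hz, relLinkVec_conj]

/-- The same as an eventual identity of functions near any `z₀` with `‖z₀‖ < 1/4`. [folklore] -/
theorem basedFn_ad_eventuallyEq (g : SU2) {z₀ : BasedDom L} (hz₀ : ‖z₀‖ < 1 / 4) :
    (fun z => basedFn L (adDomL L g z)) =ᶠ[𝓝 z₀] fun z => adL L g (basedFn L z) := by
  have hball : ball z₀ (1 / 4) ∈ 𝓝 z₀ := ball_mem_nhds z₀ (by norm_num)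
  filter_upwards [hball] with z hz
  have hzn : ‖z‖ ≤ 1 / 2 := by
    have h1 : ‖z‖ ≤ ‖z₀‖ + dist z z₀ := by
      have := norm_le_norm_add_norm_sub' z z₀  -- ‖z‖ ≤ ‖z₀‖ + ‖z - z₀‖
      rw [← dist_eq_norm] at this; exact this
    rw [mem_ball] at hz; linarith
  exact basedFn_ad L g z hzn

/-! ## §3 ★★ Equivariance of the Laplace linear map -/

/-- ★★ **`basedLin (Ad p) (Ad ξ) = adL g (basedLin p ξ)`** for `‖p‖ < 1/4` within the differentiability radius. [folklore] -/
theorem basedLin_ad (g : SU2) : ∀ᶠ p : balancedSubmodule L × (Fin 3 → Fin 3 → ℝ) in 𝓝 0, ∀ ξ : basedSubmodule L,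
    basedLin L (adParamL L g p) (adSiteL L g ξ) = adL L g (basedLin L p ξ) := by
  -- differentiability of `fB` near `0`, at `(0,p)` and at `(0, Ad p)`
  have hdiff : ∀ᶠ z : BasedDom L in 𝓝 0, DifferentiableAt ℝ (basedFn L) z := by
    have h := (contDiffAt_basedFn L (n := 1)).eventually (by simp)
    filter_upwards [h] with z hz using hz.differentiableAt one_ne_zero
  obtain ⟨ε, hε, hball⟩ := Metric.mem_nhds_iff.mp hdiff
  have hsmall : ∀ᶠ p : balancedSubmodule L × (Fin 3 → Fin 3 → ℝ) in 𝓝 0, ‖p‖ < min (ε / 2) (1 / 4) := by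
    have := ball_mem_nhds (0 : balancedSubmodule L × (Fin 3 → Fin 3 → ℝ)) (lt_min (half_pos hε) (by norm_num : (0:ℝ) < 1 / 4))
    filter_upwards [this] with p hp; rwa [mem_ball, dist_zero_right] at hp
  filter_upwards [hsmall] with p hp ξ
  have hpε : ‖p‖ < ε / 2 := lt_of_lt_of_le hp (min_le_left _ _)
  have hp4 : ‖p‖ < 1 / 4 := lt_of_lt_of_le hp (min_le_right _ _)
  -- the base points
  have hnorm0 : ‖((0 : basedSubmodule L), p)‖ = ‖p‖ := by
    rw [Prod.norm_def, norm_zero, max_eq_right (norm_nonneg _)]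
  have hz₀ : ‖((0 : basedSubmodule L), p)‖ < 1 / 4 := by rw [hnorm0]; exact hp4
  have hz₀ε : ((0 : basedSubmodule L), p) ∈ ball (0 : BasedDom L) ε := by
    rw [mem_ball, dist_zero_right, hnorm0]; linarith
  have hAdz : adDomL L g ((0 : basedSubmodule L), p) = ((0 : basedSubmodule L), adParamL L g p) := by
    rw [adDomL_apply, map_zero]
  have hz₁ε : ((0 : basedSubmodule L), adParamL L g p) ∈ ball (0 : BasedDom L) ε := by
    rw [mem_ball, dist_zero_right, ← hAdz]
    calc ‖adDomL L g (0, p)‖ ≤ 2 * ‖((0 : basedSubmodule L), p)‖ := norm_adDomL_le L g _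
      _ < ε := by rw [hnorm0]; linarith
  have hd₀ : DifferentiableAt ℝ (basedFn L) ((0 : basedSubmodule L), p) := hball hz₀ε
  have hd₁ : DifferentiableAt ℝ (basedFn L) ((0 : basedSubmodule L), adParamL L g p) := hball hz₁ε
  -- chain rule on `z ↦ fB (Ad z)` at `(0,p)` and the local identity
  have hchain : fderiv ℝ (fun z => basedFn L (adDomL L g z)) ((0 : basedSubmodule L), p) =
      (fderiv ℝ (basedFn L) ((0 : basedSubmodule L), adParamL L g p)).comp (adDomL L g) := by
    have h := (hAdz ▸ hd₁).hasFDerivAt.comp ((0 : basedSubmodule L), p) (adDomL L g).hasFDerivAt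
    rw [hAdz] at h
    exact h.fderiv
  have hlin : fderiv ℝ (fun z => adL L g (basedFn L z)) ((0 : basedSubmodule L), p) =
      ((adL L g).toLinearIsometry.toContinuousLinearMap).comp (fderiv ℝ (basedFn L) ((0 : basedSubmodule L), p)) :=
    (((adL L g).toLinearIsometry.toContinuousLinearMap).hasFDerivAt.comp ((0 : basedSubmodule L), p) hd₀.hasFDerivAt).fderiv
  have heq := Filter.EventuallyEq.fderiv_eq (𝕜 := ℝ) (basedFn_ad_eventuallyEq L g hz₀)
  rw [hchain, hlin] at heq
  -- evaluate at `(ξ, 0)`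
  have h := congrArg (fun T : BasedDom L →L[ℝ] LinkSpace L => T (ξ, 0)) heq
  simp only [ContinuousLinearMap.comp_apply, adDomL_apply, map_zero] at h
  show (fderiv ℝ (basedFn L) (0, adParamL L g p)) ((adSiteL L g) ξ, 0) = adL L g ((fderiv ℝ (basedFn L) (0, p)) (ξ, 0))
  exact h

end Summit.QuantumFields.YangMills.Theorems.FemtoTransferGap.TwoLattice.ConstTube

end
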